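import Literature.MathematicalPhysics.QuantumFieldTheory.Balaban1983to89.B9Thm312WholeLeafRelH
import Literature.MathematicalPhysics.QuantumFieldTheory.Balaban1983to89.B9Thm312WholeBlocksNbr
import Literature.MathematicalPhysics.QuantumFieldTheory.Balaban1983to89.B9Thm312WholeHHolderNbr
import Literature.MathematicalPhysics.QuantumFieldTheory.Balaban1983to89.B9Thm312WholeLeafAll

/-!
# `Balaban1983to89.B9Thm312WholeLeafCompleteNbr` — [B9] Theorem 3.12 (p. 423) AS THE WHOLE PRINTED LEAF `B9.Thm312Printed` AT THE PINS WITH NO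
# DISPLAYED RESIDUAL, EVERY CO-READING IN A DISCHARGEABLE SPECIES: the (3.43)–(3.46) quantities and the Hölder member of (3.133) read on the
# METRIC NEIGHBOURHOOD of y (n06-k's `Nbr` species), the second-order L² lines as direction-pair families

T. Bałaban, *Propagators for lattice gauge theories in a background field*, Commun. Math. Phys. **99** (1985) 389–434
[`Balaban1985BackgroundPropagators`, "B9"]; [4] = T. Bałaban, *Propagators and renormalization transformations for lattice
gauge theories. II*, Commun. Math. Phys. **96** (1984) 223–250 [`Balaban1984PropagatorsII`].

statement-level skeleton of published theorems with citation tags; proofs where landed; nothing here is a claim about the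
Yang–Mills mass gap

THE PRINTED LOCI are those of `…B9Thm312WholeLeafRelH`, `…B9Thm312WholeBlocksNbr` and `…B9Thm312WholeHHolderNbr` (verbatim there).

WHY THIS FILE (successor of `…B9Thm312WholeLeafComplete.thm312Printed_complete`, same seat).  That leaf reads the (3.43)–(3.46) quantities of
`GD i`, `G₁ i` through `L2ReadsRel` ∕ `H1ReadsRel` ∕ `InputReadsRel` and the Hölder member of (3.133) through `CoReadsHHolderRel` — schemas whose
observation is sited on the CLASS of y and which are NOT dischargeable at the record geometry (n06-k's located obstructions (O1)∕(O2), kernel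
negative `B9RWSumsReadsRelNegative.not_l2ReadsRel_evBK`), so at the instance those binders could only be carried vacuously.  THIS FILE proves
the same residual-free leaf with those four co-reading families replaced by their NEIGHBOURHOOD-SITED re-typings `B9RWSumsReadsNbr.L2ReadsNbr` ∕
`H1ReadsNbr` ∕ `InputReadsNbr` (the species n06-d discharges at the record, `B9CoReadingCoordsL2.l2ReadsNbr_kernelFamilyB_coords_*`) and
`B9Thm312WholeHHolderNbr.CoReadsHHolderNbr`, and with the two second-order L² lines modelled print-faithfully by the direction-pair families
∇_{U,ν}∇_{U,μ}A, A∇\*_{U,ν}∇\*_{U,μ} packaged by `familyOp` (letters `Dd Dds`, schema `Thm33G0L2P`).  ROUTE: the landed leaf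
`B9Thm312WholeLeafRelH.thm312Printed_of_stepRelH` (whose remaining co-readings `CoRealizesRel` ∕ `CoReadsGlob` ∕ `CoRealizesHRel` are the
dischargeable species of n06-d's `B9CoReadingCoords*`) is fed, as its residual `hres`, the two typed blocks `L2Block K … U ∧ B9.Ineq343_345 K … U`
for K ∈ [G_D, G₁] from `B9Thm312WholeBlocksNbr.l2Block_of_step_nbr` ∕ `holder_of_step_nbr` and the Hölder member of (3.133) for H, H₁ from
`B9Thm312WholeHHolderNbr.hkh_of_step_nbr`, per member and per configuration, weakened to uniform constants (threshold max(M₁, M_L, M_L′),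
smallness min(a₁, (2(θ₁c + 1))⁻¹, (2(B₂θ₂c² + 1))⁻¹), rate ρ_f).

WHAT THIS FILE PROVES: `constL2N_le` (the uniform bound of the L² constant) and ★★ `thm312Printed_completeNbr` (0 `def`, 0 named fact, 0 sorry).
New binders versus `thm312Printed_complete`: the radius `r`, the evaluation constant `Cev ≧ 0`, the neighbourhood count `mN`
(`(nbr (geo i) r y).card ≤ mN`), the level comparability `CL ≧ 1` (`d(a,a′) ≤ r ⇒ Lʲ⁽ᵃ⁾η ≤ CL·Lʲ⁽ᵃ′⁾η`), the direction type `P` with the letters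
`Dd Dds`; `Lap` and the second-argument saturation `hRdist'` are gone (the latter follows from `hRdist` and the symmetry of d).

HONEST SCOPE.  Nothing of print is asserted; every schema is a HYPOTHESIS of printed shape whose derivation (located gap G-B9-16) is not typed;
kernel-checked bookkeeping — NOT a node discharge, NOT summit progress; one finite lattice at a time; nothing continuum, nothing about the mass
gap.  Cell `pub-ymgap` (HUMAN RULING D-0062), Track A node N06 [B9], N06-ASSIGNMENT v1 row 20 (bundle F7), seat `pub-ymgap-dag-n06-l` (g5),
2026-08-27.
-/

namespace Literature.MathematicalPhysics.QuantumFieldTheory.Balaban1983to89.B9Thm312WholeLeafCompleteNbr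

open Literature.MathematicalPhysics.QuantumFieldTheory.Balaban1983to89
open Finset B6RandomWalk B6RandomWalkHom B9Thm34Ext B9Thm37Glue B9Thm37GlueCor36 B11SectG B9SectDSup B9SectDL2Decay
open B9Thm37AllNorms B9Thm37AllNormsInstances B9FromB6 B9FromB6ModelSignsOn B9SectBStepWhole B9Thm312Whole B9Thm312WholeLeaf
open B9Thm312WholeLeft B9Thm312WholeH B9Thm312WholeLeafLeftGlob B9Ineq347CoReading B9SectCDiffDict B9CoRealizesRel B9CoRealizesHRel
open B9RWSums343Holder B9RWSumsReadsRel B9RWSumsReadsNbr B9Ineq347 B9Thm312WholeClasses B9Thm312WholeHolder B9Thm312WholeL2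
open B9Thm312WholeBlocksRel B9Thm312WholeBlocksNbr B9Thm312WholeLeafAll B9Thm312WholeHHolder B9Thm312WholeHHolderNbr B9Thm312WholeLeafRelH
open B9RWSums346SecondDiff

noncomputable section

section Helpers

/-- The uniform bound of the L² constant `constL2N` along the family: with (1 − θc)⁻¹ ≦ 2, (1 − B₂θ₂c²)⁻¹ ≦ 2, θ_D ≦ t_D, θ₂ ≦ t₂, N_P ≧ 0 and the
three transfer constants below Λ_u, `constL2N B₀ θ θ_D B₂ θ₂ c Λ₁ Λ_h Λ₋ N_P ≦ 2B₀Λ_u + (B₀ + t_D(2B₀)c + 2B₀)Λ_u + (B₂ + B₂(t₂(2B₂)c)c)(1 + N_PΛ_u + N_PΛ_u)`.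
[cite: Balaban1985BackgroundPropagators, Thm 3.12 p.423 («for α₀ sufficiently small», bookkeeping)] -/
theorem constL2N_le {B₀ θ θD tD B₂ θ₂ t₂ c Λ₁ Λh Λm Λu NP : ℝ} (hB₀ : 0 ≤ B₀) (hB₂ : 0 ≤ B₂) (hc : 0 ≤ c) (hθD : 0 ≤ θD)
    (hθDle : θD ≤ tD) (hθ₂ : 0 ≤ θ₂) (hθ₂le : θ₂ ≤ t₂) (hq : θ * c ≤ 1 / 2) (hq₂ : B₂ * θ₂ * c * c ≤ 1 / 2) (hNP : 0 ≤ NP)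
    (hΛ₁ : 0 ≤ Λ₁) (hΛ₁le : Λ₁ ≤ Λu) (hΛh : 0 ≤ Λh) (hΛhle : Λh ≤ Λu) (hΛm : 0 ≤ Λm) (hΛmle : Λm ≤ Λu) :
    constL2N B₀ θ θD B₂ θ₂ c Λ₁ Λh Λm NP ≤
      2 * B₀ * Λu + (B₀ + tD * (2 * B₀) * c + 2 * B₀) * Λu + (B₂ + B₂ * (t₂ * (2 * B₂) * c) * c) * (1 + NP * Λu + NP * Λu) := by
  -- adapted from `B9Thm312WholeLeafAll.constL2_le` (the packaging constant N_P on the second-order lines)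
  have hX0 : 0 ≤ (1 - θ * c)⁻¹ := inv_nonneg.mpr (by linarith)
  have hX : B₀ * (1 - θ * c)⁻¹ ≤ 2 * B₀ := const_le_two_mul hB₀ hq
  have hBX0 : 0 ≤ B₀ * (1 - θ * c)⁻¹ := mul_nonneg hB₀ hX0
  have hY0 : 0 ≤ (1 - B₂ * θ₂ * c * c)⁻¹ := inv_nonneg.mpr (by linarith)
  have hY : B₂ * (1 - B₂ * θ₂ * c * c)⁻¹ ≤ 2 * B₂ := const_le_two_mul hB₂ hq₂
  have hBY0 : 0 ≤ B₂ * (1 - B₂ * θ₂ * c * c)⁻¹ := mul_nonneg hB₂ hY0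
  have htD : 0 ≤ tD := hθD.trans hθDle
  have ht₂ : 0 ≤ t₂ := hθ₂.trans hθ₂le
  have hΛu : 0 ≤ Λu := hΛ₁.trans hΛ₁le
  have h1 : B₀ * (1 - θ * c)⁻¹ * Λ₁ ≤ 2 * B₀ * Λu := mul_le_mul hX hΛ₁le hΛ₁ (by linarith)
  have h2a : θD * (B₀ * (1 - θ * c)⁻¹) * c ≤ tD * (2 * B₀) * c :=
    mul_le_mul_of_nonneg_right (mul_le_mul hθDle hX hBX0 htD) hc
  have h2b : B₀ + θD * (B₀ * (1 - θ * c)⁻¹) * c + B₀ * (1 - θ * c)⁻¹ ≤ B₀ + tD * (2 * B₀) * c + 2 * B₀ := by linarith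
  have h2c : 0 ≤ B₀ + θD * (B₀ * (1 - θ * c)⁻¹) * c + B₀ * (1 - θ * c)⁻¹ :=
    add_nonneg (add_nonneg hB₀ (mul_nonneg (mul_nonneg hθD hBX0) hc)) hBX0
  have h2 : (B₀ + θD * (B₀ * (1 - θ * c)⁻¹) * c + B₀ * (1 - θ * c)⁻¹) * Λh ≤ (B₀ + tD * (2 * B₀) * c + 2 * B₀) * Λu :=
    mul_le_mul h2b hΛhle hΛh (h2c.trans h2b)
  have h3a : θ₂ * (B₂ * (1 - B₂ * θ₂ * c * c)⁻¹) * c ≤ t₂ * (2 * B₂) * c :=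
    mul_le_mul_of_nonneg_right (mul_le_mul hθ₂le hY hBY0 ht₂) hc
  have h3a0 : 0 ≤ θ₂ * (B₂ * (1 - B₂ * θ₂ * c * c)⁻¹) * c := mul_nonneg (mul_nonneg hθ₂ hBY0) hc
  have h3b : B₂ + B₂ * (θ₂ * (B₂ * (1 - B₂ * θ₂ * c * c)⁻¹) * c) * c ≤ B₂ + B₂ * (t₂ * (2 * B₂) * c) * c := by
    have := mul_le_mul_of_nonneg_right (mul_le_mul_of_nonneg_left h3a hB₂) hc
    linarith
  have h3c : 0 ≤ B₂ + B₂ * (θ₂ * (B₂ * (1 - B₂ * θ₂ * c * c)⁻¹) * c) * c :=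
    add_nonneg hB₂ (mul_nonneg (mul_nonneg hB₂ h3a0) hc)
  have hN1 : NP * Λ₁ ≤ NP * Λu := mul_le_mul_of_nonneg_left hΛ₁le hNP
  have hNm : NP * Λm ≤ NP * Λu := mul_le_mul_of_nonneg_left hΛmle hNP
  have hN0 : 0 ≤ NP * Λ₁ := mul_nonneg hNP hΛ₁
  have hN0' : 0 ≤ NP * Λm := mul_nonneg hNP hΛm
  have h3 : (B₂ + B₂ * (θ₂ * (B₂ * (1 - B₂ * θ₂ * c * c)⁻¹) * c) * c) * (1 + NP * Λ₁ + NP * Λm) ≤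
      (B₂ + B₂ * (t₂ * (2 * B₂) * c) * c) * (1 + NP * Λu + NP * Λu) :=
    mul_le_mul h3b (by linarith) (by linarith) (h3c.trans h3b)
  unfold constL2N
  linarith

end Helpers

/-! ## The leaf of row 20 with no displayed residual, neighbourhood-sited co-readings -/

section Family

variable {I : Type} {d : ℕ} {c35 : ℝ} {geo : I → B9.Geometry} {bg : I → B9.Backgrounds}
variable [∀ i, Fintype (geo i).Site] [∀ i, DecidableEq (geo i).Site]
variable {X Y Z W PX PY : I → Type} {P : Type} [∀ i, Fintype (X i)] [∀ i, DecidableEq (X i)] [∀ i, Fintype (Y i)]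
  [∀ i, Fintype (Z i)] [∀ i, Fintype (W i)] [∀ i, Fintype (PX i)] [∀ i, Fintype (PY i)] [Fintype P]

omit [∀ i, Fintype (X i)] [∀ i, DecidableEq (X i)] [∀ i, Fintype (Y i)] [∀ i, Fintype (Z i)] [∀ i, Fintype (W i)]
  [∀ i, Fintype (geo i).Site] [∀ i, DecidableEq (geo i).Site] [∀ i, Fintype (PX i)] [∀ i, Fintype (PY i)] [Fintype P] in
/-- Arithmetic of *"for α₀ sufficiently small"*: t ≧ 0 and m ≦ (2(t + 1))⁻¹ give tm ≦ ½. [folklore] -/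
private theorem small_aux₁₀ {t m : ℝ} (ht : 0 ≤ t) (hm : m ≤ (2 * (t + 1))⁻¹) : t * m ≤ 1 / 2 := by
  have hpos : 0 < 2 * (t + 1) := by linarith
  have h1 : t * m ≤ t * (2 * (t + 1))⁻¹ := mul_le_mul_of_nonneg_left hm ht
  have h2 : t * (2 * (t + 1))⁻¹ ≤ 1 / 2 := by
    rw [← div_eq_mul_inv, div_le_iff₀ hpos]
    linarith
  linarith

-- heartbeat budget (v1.1, pre-emptive): this one-block proof elaborates at ≈ 130–160k heartbeats on the farm — the band in which two
-- sibling leaves failed `lake build` at the 200k default (2026-08-27); statement and proof byte-identical to v1.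
set_option maxHeartbeats 400000 in
/-- ★★ **THEOREM 3.12 AS THE WHOLE PRINTED LEAF `B9.Thm312Printed`, AT THE PINS — NO DISPLAYED RESIDUAL, NEIGHBOURHOOD-SITED CO-READINGS** (p. 423).
Inputs: those of `B9Thm312WholeLeafComplete.thm312Printed_complete` with the four class-sited co-reading families replaced by their
neighbourhood-sited re-typings — `hl2N` (`L2ReadsNbr` ×6 for G_D, ×6 for G₁; lines 3∕5 by the packaged pair families
`familyOp (q ↦ ∇_{q.1}∇_{q.2}∘A)`, `familyOp (q ↦ A∘∇\*_{q.1}∇\*_{q.2})` into X × (P × P), block map `blk ∘ Prod.fst`), `hH1N` (`H1ReadsNbr` ×2), `hIN`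
(`InputReadsNbr` ×2), `hHCN` (`CoReadsHHolderNbr` ×2) — the direction letters `Dd Dds` with Theorem 3.3 for G₀ in the pair-indexed L² classes
(`hG0C : Thm33G0H ∧ Thm33G0L2P`), and the neighbourhood data (radius r, evaluation constant Cev ≧ 0, count mN, level comparability CL ≧ 1).  PROVED
INSIDE: every member — (3.42)₁,₂,₃, (3.46)₀₋₅, (3.43)–(3.45), (3.47)₀,₁,₂ for G_D, G₁; all three members of (3.133) for H, H₁; Theorem 3.11; the pins.
Route: `thm312Printed_of_stepRelH` with the threshold max(M₁, M_L, M_L′), the smallness min(a₁, (2(θ₁c + 1))⁻¹, (2(B₂θ₂c² + 1))⁻¹) and `hres`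
supplied by `B9Thm312WholeBlocksNbr.l2Block_of_step_nbr` ∕ `holder_of_step_nbr` (twice per member) and `B9Thm312WholeHHolderNbr.hkh_of_step_nbr`
(for H and H₁) at uniform constants and the rate ρ_f.  Nothing of print asserted; NOT a node discharge.
[cite: Balaban1985BackgroundPropagators, Thm 3.12 pp.421–423 + (3.39)–(3.47) pp.397–398 + (3.126) p.420 + (3.129) p.421 + (3.132)–(3.133) p.422; Balaban1984PropagatorsII, (2.51)–(2.52) p.232 + Lemma 2.1 (2.60)–(2.61) p.234] -/
theorem thm312Printed_completeNbr (𝔬 : ∀ i, Ops (geo i) (bg i) (X i) (Y i) (Z i) (W i)) (R₀ : I → ℝ) (H₀ : I → Prop)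
    (𝔭 : ∀ i, HolderProbes (geo i) (bg i) (X i) (Y i) (PX i) (PY i))
    (bH : ∀ i, ℝ → BlockNorm (toB6 (geo i) (R₀ i) (H₀ i)) (Y i → ℝ))
    (Dd Dds : ∀ i, (bg i).Cfg → P → Module.End ℝ (X i → ℝ))
    (GD G₁ : ∀ i, B9.KernelFamily (geo i) (bg i)) (Hk H₁k : ∀ i, B9.HKernel (geo i) (bg i))
    (ev : ∀ i, (geo i).Loc → X i → ℝ) (evY : ∀ i, (geo i).Loc → Y i → ℝ) {PL : ∀ i, (geo i).Loc → Prop}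
    (Rel : ∀ i, (geo i).Site → (geo i).Site → Prop) [∀ i, DecidableRel (Rel i)] (m mN : ℕ)
    (r Cev CL θ₁ θD θH θ₂ r₁ B₀ B₂ δ₀ δK σ c ρ ρf a₁ M₁ ML B₃ δ₃ α Lc : ℝ) (Bh Bi Bq : ℝ → ℝ) (Bi2 : ℝ → ℝ → ℝ)
    (hθ₁ : 0 ≤ θ₁) (hθD : 0 ≤ θD) (hθH : 0 ≤ θH) (hθ₂ : 0 ≤ θ₂) (hr₁ : 0 ≤ r₁) (hB₀ : 0 ≤ B₀) (hB₂ : 0 ≤ B₂) (hB₃ : 0 ≤ B₃)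
    (hσ : 0 ≤ σ) (hρ : 0 < ρ) (hρS : ρ ≤ δ₀) (hρδ : ρ + σ ≤ δK) (hρ₃ : ρ + σ ≤ δ₃) (hc : 0 ≤ c) (ha₁ : 0 < a₁) (hM₁ : 0 < M₁)
    (hα : α ≤ 1 / 2) (hα0 : 0 ≤ α) (hρf : 0 < ρf) (hρf1 : ρf + σ ≤ (1 - α) * ρ) (hρf2 : ρf + 2 * σ + α * ρ ≤ ρ)
    (hBh : ∀ β, 0 ≤ β → β < 1 → 0 ≤ Bh β) (hBi : ∀ ε, 0 < ε → ε ≤ 1 → 0 ≤ Bi ε)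
    (hBi2 : ∀ ε β, 0 < ε → ε ≤ 1 → 0 ≤ β → β < 1 → 0 ≤ Bi2 ε β) (hBq : ∀ β, 0 ≤ Bq β)
    (hCev : 0 ≤ Cev) (hCL1 : 1 ≤ CL)
    (hgeo : ∀ i, GeoOK (geo i)) (S : ∀ i, ModelSignsOn (geo i) (PL i))
    (hL1 : ∀ i, 1 ≤ (geo i).L) (hLle : ∀ i, (geo i).L ≤ Lc) (hLc : 1 ≤ Lc) (hη : ∀ i, 0 < (geo i).eta)
    (hrow : ∀ i, ML ≤ (geo i).M → RowSum (toB6 (geo i) (R₀ i) (H₀ i)) σ c)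
    (hL21 : ∀ δ : ℝ, 0 < δ → ∃ ML' c' : ℝ, Lemma21AboveG geo R₀ H₀ δ α ML' c')
    (hnbr : ∀ (i : I) (y : (geo i).Site), (nbr (geo i) r y).card ≤ mN)
    (hCL : ∀ (i : I) (a a' : (geo i).Site), (geo i).dist a a' ≤ r → (geo i).len a ≤ CL * (geo i).len a')
    (hsat : ∀ (i : I) (n : Fin 4) (B' δ' : ℝ),
      (∀ a a' b, Rel i a a' → maj342 (geo i) n B' δ' a b = maj342 (geo i) n B' δ' a' b) ∧
      (∀ a b b', Rel i b b' → maj342 (geo i) n B' δ' a b = maj342 (geo i) n B' δ' a b'))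
    (hmult : ∀ (i : I) (y' : (geo i).Site), (Finset.univ.filter (fun y'' => Rel i y'' y')).card ≤ m)
    (hRdist : ∀ (i : I) (a a' b : (geo i).Site), Rel i a a' → (geo i).dist a b = (geo i).dist a' b)
    (hRlen : ∀ (i : I) (a a' : (geo i).Site), Rel i a a' → (geo i).len a = (geo i).len a')
    (hcoR : ∀ (i : I) (U : (bg i).Cfg),
      CoRealizesRel (GD i) 0 U (Rel i) (𝔬 i).blk (𝔬 i).blk (ev i) ((𝔬 i).G U) ∧
      CoRealizesRel (GD i) 2 U (Rel i) (𝔬 i).blk (𝔬 i).blkY (evY i) ((𝔬 i).G U ∘ₗ (𝔬 i).Dstar U) ∧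
      CoRealizesRel (G₁ i) 0 U (Rel i) (𝔬 i).blk (𝔬 i).blk (ev i) ((𝔬 i).G1 U) ∧
      CoRealizesRel (G₁ i) 2 U (Rel i) (𝔬 i).blk (𝔬 i).blkY (evY i) ((𝔬 i).G1 U ∘ₗ (𝔬 i).Dstar U))
    (hco1R : ∀ (i : I) (U : (bg i).Cfg),
      CoRealizesRel (GD i) 1 U (Rel i) (𝔬 i).blkY (𝔬 i).blk (ev i) ((𝔬 i).D U ∘ₗ (𝔬 i).G U) ∧
      CoRealizesRel (G₁ i) 1 U (Rel i) (𝔬 i).blkY (𝔬 i).blk (ev i) ((𝔬 i).D U ∘ₗ (𝔬 i).G1 U))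
    (hcoHR : ∀ (i : I) (U : (bg i).Cfg),
      CoRealizesHRel (Hk i) 0 U d (Rel i) (𝔬 i).blk (𝔬 i).blkZ ((𝔬 i).Hm U) ∧
      CoRealizesHRel (Hk i) 1 U d (Rel i) (𝔬 i).blkY (𝔬 i).blkZ ((𝔬 i).D U ∘ₗ (𝔬 i).Hm U) ∧
      CoRealizesHRel (H₁k i) 0 U d (Rel i) (𝔬 i).blk (𝔬 i).blkZ ((𝔬 i).H1m U) ∧
      CoRealizesHRel (H₁k i) 1 U d (Rel i) (𝔬 i).blkY (𝔬 i).blkZ ((𝔬 i).D U ∘ₗ (𝔬 i).H1m U))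
    (hcoG : ∀ (i : I) (U : (bg i).Cfg),
      CoReadsGlob (GD i) 0 U (𝔬 i).blk (𝔬 i).blk (ev i) ((𝔬 i).G U) ∧
      CoReadsGlob (GD i) 1 U (𝔬 i).blkY (𝔬 i).blk (ev i) ((𝔬 i).D U ∘ₗ (𝔬 i).G U) ∧
      CoReadsGlob (GD i) 2 U (𝔬 i).blk (𝔬 i).blkY (evY i) ((𝔬 i).G U ∘ₗ (𝔬 i).Dstar U) ∧
      CoReadsGlob (G₁ i) 0 U (𝔬 i).blk (𝔬 i).blk (ev i) ((𝔬 i).G1 U) ∧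
      CoReadsGlob (G₁ i) 1 U (𝔬 i).blkY (𝔬 i).blk (ev i) ((𝔬 i).D U ∘ₗ (𝔬 i).G1 U) ∧
      CoReadsGlob (G₁ i) 2 U (𝔬 i).blk (𝔬 i).blkY (evY i) ((𝔬 i).G1 U ∘ₗ (𝔬 i).Dstar U))
    (hl2N : ∀ (i : I) (U : (bg i).Cfg),
      (L2ReadsNbr (R := R₀ i) (H := H₀ i) (GD i) 0 U (Rel i) r Cev (𝔬 i).blk (𝔬 i).blk (ev i) ((𝔬 i).G U) ∧
        L2ReadsNbr (R := R₀ i) (H := H₀ i) (GD i) 1 U (Rel i) r Cev (𝔬 i).blkY (𝔬 i).blk (ev i) ((𝔬 i).D U ∘ₗ (𝔬 i).G U) ∧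
        L2ReadsNbr (R := R₀ i) (H := H₀ i) (GD i) 2 U (Rel i) r Cev (𝔬 i).blk (𝔬 i).blkY (evY i) ((𝔬 i).G U ∘ₗ (𝔬 i).Dstar U) ∧
        L2ReadsNbr (R := R₀ i) (H := H₀ i) (GD i) 3 U (Rel i) r Cev ((𝔬 i).blk ∘ Prod.fst) (𝔬 i).blk (ev i)
          (familyOp (fun q : P × P => (Dd i U q.1 ∘ₗ Dd i U q.2) ∘ₗ (𝔬 i).G U)) ∧
        L2ReadsNbr (R := R₀ i) (H := H₀ i) (GD i) 4 U (Rel i) r Cev (𝔬 i).blkY (𝔬 i).blkY (evY i)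
          ((𝔬 i).D U ∘ₗ ((𝔬 i).G U ∘ₗ (𝔬 i).Dstar U)) ∧
        L2ReadsNbr (R := R₀ i) (H := H₀ i) (GD i) 5 U (Rel i) r Cev ((𝔬 i).blk ∘ Prod.fst) (𝔬 i).blk (ev i)
          (familyOp (fun q : P × P => (𝔬 i).G U ∘ₗ (Dds i U q.1 ∘ₗ Dds i U q.2)))) ∧
      (L2ReadsNbr (R := R₀ i) (H := H₀ i) (G₁ i) 0 U (Rel i) r Cev (𝔬 i).blk (𝔬 i).blk (ev i) ((𝔬 i).G1 U) ∧
        L2ReadsNbr (R := R₀ i) (H := H₀ i) (G₁ i) 1 U (Rel i) r Cev (𝔬 i).blkY (𝔬 i).blk (ev i) ((𝔬 i).D U ∘ₗ (𝔬 i).G1 U) ∧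
        L2ReadsNbr (R := R₀ i) (H := H₀ i) (G₁ i) 2 U (Rel i) r Cev (𝔬 i).blk (𝔬 i).blkY (evY i) ((𝔬 i).G1 U ∘ₗ (𝔬 i).Dstar U) ∧
        L2ReadsNbr (R := R₀ i) (H := H₀ i) (G₁ i) 3 U (Rel i) r Cev ((𝔬 i).blk ∘ Prod.fst) (𝔬 i).blk (ev i)
          (familyOp (fun q : P × P => (Dd i U q.1 ∘ₗ Dd i U q.2) ∘ₗ (𝔬 i).G1 U)) ∧
        L2ReadsNbr (R := R₀ i) (H := H₀ i) (G₁ i) 4 U (Rel i) r Cev (𝔬 i).blkY (𝔬 i).blkY (evY i)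
          ((𝔬 i).D U ∘ₗ ((𝔬 i).G1 U ∘ₗ (𝔬 i).Dstar U)) ∧
        L2ReadsNbr (R := R₀ i) (H := H₀ i) (G₁ i) 5 U (Rel i) r Cev ((𝔬 i).blk ∘ Prod.fst) (𝔬 i).blk (ev i)
          (familyOp (fun q : P × P => (𝔬 i).G1 U ∘ₗ (Dds i U q.1 ∘ₗ Dds i U q.2)))))
    (hH1N : ∀ (i : I) (U : (bg i).Cfg),
      H1ReadsNbr (GD i) U (𝔭 i) (Rel i) r (𝔬 i).blk (𝔬 i).blkY (ev i) (evY i) ((𝔬 i).D U ∘ₗ (𝔬 i).G U)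
        ((𝔬 i).G U ∘ₗ (𝔬 i).Dstar U) ∧
      H1ReadsNbr (G₁ i) U (𝔭 i) (Rel i) r (𝔬 i).blk (𝔬 i).blkY (ev i) (evY i) ((𝔬 i).D U ∘ₗ (𝔬 i).G1 U)
        ((𝔬 i).G1 U ∘ₗ (𝔬 i).Dstar U))
    (hIN : ∀ (i : I) (U : (bg i).Cfg),
      InputReadsNbr (GD i) U (𝔭 i) (bH i) r (𝔬 i).blkY (evY i) ((𝔬 i).D U ∘ₗ ((𝔬 i).G U ∘ₗ (𝔬 i).Dstar U)) ∧
      InputReadsNbr (G₁ i) U (𝔭 i) (bH i) r (𝔬 i).blkY (evY i) ((𝔬 i).D U ∘ₗ ((𝔬 i).G1 U ∘ₗ (𝔬 i).Dstar U)))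
    (hHCN : ∀ (i : I) (U : (bg i).Cfg),
      CoReadsHHolderNbr (Hk i) U d (𝔭 i) r (𝔬 i).blkZ ((𝔬 i).D U ∘ₗ (𝔬 i).Hm U) ∧
      CoReadsHHolderNbr (H₁k i) U d (𝔭 i) r (𝔬 i).blkZ ((𝔬 i).D U ∘ₗ (𝔬 i).H1m U))
    (hsym : ∀ (i : I) (U : (bg i).Cfg), IsTransposePair ((𝔬 i).G U) ((𝔬 i).G U) ∧ IsTransposePair ((𝔬 i).G1 U) ((𝔬 i).G1 U))
    (htr : ∀ (i : I) (U : (bg i).Cfg),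
      IsTransposePair ((𝔬 i).D U ∘ₗ (𝔬 i).G U) ((𝔬 i).G U ∘ₗ (𝔬 i).Dstar U) ∧
      IsTransposePair ((𝔬 i).D U ∘ₗ (𝔬 i).G1 U) ((𝔬 i).G1 U ∘ₗ (𝔬 i).Dstar U))
    (hmodel : ∀ i, M₁ ≤ (geo i).M → ∀ α₀ : ℝ, 0 < α₀ → (geo i).M * α₀ ≤ a₁ →
      ∀ U : (bg i).Cfg, (bg i).Reg335 c35 α₀ U → (bg i).Reg336 c35 α₀ U →
        Thm33G0 (𝔬 i) (R₀ i) (H₀ i) B₀ δ₀ U ∧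
        Step (𝔬 i) (R₀ i) (H₀ i) (hgeo i).lenle 1 (θ₁ * ((geo i).M * α₀)) δK U ∧
        Step (𝔬 i) (R₀ i) (H₀ i) (hgeo i).lenle 2 (θ₁ * ((geo i).M * α₀)) δK U ∧
        FormSmall (𝔬 i) (r₁ * ((geo i).M * α₀)) U ∧ Identities (𝔬 i) U)
    (hleft : ∀ i, M₁ ≤ (geo i).M → ∀ α₀ : ℝ, 0 < α₀ → (geo i).M * α₀ ≤ a₁ →
      ∀ U : (bg i).Cfg, (bg i).Reg335 c35 α₀ U → (bg i).Reg336 c35 α₀ U →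
        LeftStep (𝔬 i) (R₀ i) (H₀ i) (hgeo i).lenle B₀ δ₀ (θD * ((geo i).M * α₀)) δK U)
    (hlettersH : ∀ i, M₁ ≤ (geo i).M → ∀ α₀ : ℝ, 0 < α₀ → (geo i).M * α₀ ≤ a₁ →
      ∀ U : (bg i).Cfg, (bg i).Reg335 c35 α₀ U → (bg i).Reg336 c35 α₀ U →
        LettersH (𝔬 i) (R₀ i) (H₀ i) (hgeo i) B₃ δ₃ U)
    (hG0C : ∀ i, M₁ ≤ (geo i).M → ∀ α₀ : ℝ, 0 < α₀ → (geo i).M * α₀ ≤ a₁ →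
      ∀ U : (bg i).Cfg, (bg i).Reg335 c35 α₀ U → (bg i).Reg336 c35 α₀ U →
        Thm33G0H (𝔬 i) (𝔭 i) (R₀ i) (H₀ i) (bH i) Bh Bi Bi2 δ₀ U ∧ Thm33G0L2P (𝔬 i) (Dd i) (Dds i) (R₀ i) (H₀ i) B₂ δ₀ U)
    (hstepC : ∀ i, M₁ ≤ (geo i).M → ∀ α₀ : ℝ, 0 < α₀ → (geo i).M * α₀ ≤ a₁ →
      ∀ U : (bg i).Cfg, (bg i).Reg335 c35 α₀ U → (bg i).Reg336 c35 α₀ U →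
        StepH (𝔬 i) (𝔭 i) (R₀ i) (H₀ i) (bH i) (hgeo i).lenle (θH * ((geo i).M * α₀)) δK U ∧
        StepL2 (𝔬 i) (R₀ i) (H₀ i) (θ₂ * ((geo i).M * α₀)) δK U)
    (hLHH : ∀ i, M₁ ≤ (geo i).M → ∀ α₀ : ℝ, 0 < α₀ → (geo i).M * α₀ ≤ a₁ →
      ∀ U : (bg i).Cfg, (bg i).Reg335 c35 α₀ U → (bg i).Reg336 c35 α₀ U →
        LettersHH (𝔬 i) (𝔭 i) (R₀ i) (H₀ i) (hgeo i).lenle Bq δ₃ U) :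
    B9.Thm312Printed d c35 geo bg GD G₁ Hk H₁k (fun i => HasRWExpOfOps (𝔬 i)) (fun i => HasRWExpHOfOps (𝔬 i))
      (fun i => PosDefKOfOps (𝔬 i)) := by
  -- thresholds and uniform constants
  obtain ⟨MLg, cg, hLg⟩ := hL21 ρ hρ
  set M₁' : ℝ := max (max M₁ ML) MLg with hM₁'
  have hM₁'pos : 0 < M₁' := lt_max_of_lt_left (lt_max_of_lt_left hM₁)
  have hle₁ : ∀ {i : I}, M₁' ≤ (geo i).M → M₁ ≤ (geo i).M := fun h => ((le_max_left _ _).trans (le_max_left _ _)).trans h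
  have hleL : ∀ {i : I}, M₁' ≤ (geo i).M → ML ≤ (geo i).M := fun h => ((le_max_right _ _).trans (le_max_left _ _)).trans h
  have hleg : ∀ {i : I}, M₁' ≤ (geo i).M → MLg ≤ (geo i).M := fun h => (le_max_right _ _).trans h
  have hθc : 0 ≤ θ₁ * c := mul_nonneg hθ₁ hc
  have hB₂c : 0 ≤ B₂ * θ₂ * c * c := mul_nonneg (mul_nonneg (mul_nonneg hB₂ hθ₂) hc) hc
  set a₁' : ℝ := min a₁ (min (2 * (θ₁ * c + 1))⁻¹ (2 * (B₂ * θ₂ * c * c + 1))⁻¹) with ha₁'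
  have ha₁'pos : 0 < a₁' := lt_min ha₁ (lt_min (inv_pos.mpr (by linarith)) (inv_pos.mpr (by linarith)))
  have ha₁'le : a₁' ≤ a₁ := min_le_left _ _
  have h1α : 0 < 1 - α := by linarith
  have hB33 : 0 ≤ B₃ * B₃ * c := mul_nonneg (mul_nonneg hB₃ hB₃) hc
  have hLc0 : 0 ≤ Lc := zero_le_one.trans hLc
  have hLc2 : 0 ≤ Lc ^ (2 : ℝ) := Real.rpow_nonneg hLc0 _
  set Λu : ℝ := Lc ^ (4 : ℝ) with hΛu
  have hΛu0 : 0 ≤ Λu := Real.rpow_nonneg hLc0 _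
  set tH : ℝ := θH * a₁ with htH
  have htH0 : 0 ≤ tH := mul_nonneg hθH ha₁.le
  set BL : ℝ := B₀ + θD * a₁ * (2 * B₀) * c with hBL
  have hBL0 : 0 ≤ BL := add_nonneg hB₀ (mul_nonneg (mul_nonneg (mul_nonneg hθD ha₁.le) (by linarith)) hc)
  set NP : ℝ := Real.sqrt (Fintype.card (P × P)) with hNP
  have hNP0 : 0 ≤ NP := Real.sqrt_nonneg _
  set KLu : ℝ := 2 * B₀ * Λu + (B₀ + θD * a₁ * (2 * B₀) * c + 2 * B₀) * Λu +
    (B₂ + B₂ * (θ₂ * a₁ * (2 * B₂) * c) * c) * (1 + NP * Λu + NP * Λu) with hKLu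
  have hm00 : (0 : ℝ) ≤ m := Nat.cast_nonneg m
  have hmN0 : (0 : ℝ) ≤ mN := Nat.cast_nonneg mN
  set Fr : ℝ := (mN : ℝ) * m * Cev * CL ^ 2 * Real.exp (r * ρf) with hFr
  have hFr0 : 0 ≤ Fr := mul_nonneg (mul_nonneg (mul_nonneg (mul_nonneg hmN0 hm00) hCev) (sq_nonneg _)) (Real.exp_nonneg _)
  set BL2 : ℝ := max (Fr * KLu) 0 with hBL2
  have hBL20 : 0 ≤ BL2 := le_max_right _ _
  -- the uniform Hölder constants (the first one also serves the Hölder member of (3.133))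
  set CH3 : ℝ := CL ^ 2 * Real.exp (r * ((1 - α) * ρ)) with hCH3
  have hCH30 : 0 ≤ CH3 := mul_nonneg (sq_nonneg _) (Real.exp_nonneg _)
  set BβH : ℝ → ℝ := fun β => CH3 * ((Bq β * B₃ * c + tH * (2 * (B₃ * B₃ * c)) * c) * Lc ^ (2 : ℝ)) with hBβH
  have hBβH0 : ∀ β, 0 ≤ BβH β := fun β =>
    mul_nonneg hCH30 (mul_nonneg (add_nonneg (mul_nonneg (mul_nonneg (hBq β) hB₃) hc) (mul_nonneg (mul_nonneg htH0 (by linarith)) hc)) hLc2)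
  set Bβo : ℝ → ℝ := fun β => max ((m : ℝ) * CL * Real.exp (r * ρf) * (Bh β + tH * (2 * B₀) * c)) (BβH β) with hBβo
  have hBβo0 : ∀ β, 0 ≤ Bβo β := fun β => (hBβH0 β).trans (le_max_right _ _)
  set Bεo : ℝ → ℝ := fun ε => max (Real.exp (r * ρf) * (Bi ε + BL * Λu * tH * c)) 0 with hBεo
  have hBεo0 : ∀ ε, 0 ≤ Bεo ε := fun ε => le_max_right _ _
  set Bεβo : ℝ → ℝ → ℝ := fun ε β => max (CL * Real.exp (r * ρf) * (Bi2 ε β + (Bh β + tH * (2 * B₀) * c) * Λu * tH * c)) 0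
    with hBεβo
  have hBεβo0 : ∀ ε β, 0 ≤ Bεβo ε β := fun ε β => le_max_right _ _
  refine thm312Printed_of_stepRelH 𝔬 R₀ H₀ GD G₁ Hk H₁k ev evY Rel m θ₁ θD r₁ B₀ δ₀ δK σ c ρ a₁' M₁' ML BL2 ρf B₃ δ₃ α Lc Bβo
    Bεo Bεβo hθ₁ hθD hr₁ hB₀ hB₃ hσ hρ hρS hρδ hρ₃ hc ha₁'pos hM₁'pos hρf hα hBβo0 hBεo0 hBεβo0 hgeo S hL1 hLle hη hrow hL21 hsat
    hmult hRdist hRlen hcoR hco1R hcoHR hcoG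
    (fun i hM α₀ hα₀ hMa U hU hU' => hmodel i (hle₁ hM) α₀ hα₀ (hMa.trans ha₁'le) U hU hU')
    (fun i hM α₀ hα₀ hMa U hU hU' => hleft i (hle₁ hM) α₀ hα₀ (hMa.trans ha₁'le) U hU hU')
    (fun i hM α₀ hα₀ hMa U hU hU' => hlettersH i (hle₁ hM) α₀ hα₀ (hMa.trans ha₁'le) U hU hU') ?_
  -- the residual, PROVED per member and per configuration
  intro i hM α₀ hα₀ hMa U hU hU'
  have hM₁i : M₁ ≤ (geo i).M := hle₁ hM
  have hMpos : 0 < (geo i).M := hM₁.trans_le hM₁i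
  have hm0 : 0 ≤ (geo i).M * α₀ := (mul_pos hMpos hα₀).le
  have hma₁ : (geo i).M * α₀ ≤ a₁ := hMa.trans ha₁'le
  have hmθ : (geo i).M * α₀ ≤ (2 * (θ₁ * c + 1))⁻¹ := hMa.trans ((min_le_right _ _).trans (min_le_left _ _))
  have hm₂ : (geo i).M * α₀ ≤ (2 * (B₂ * θ₂ * c * c + 1))⁻¹ := hMa.trans ((min_le_right _ _).trans (min_le_right _ _))
  obtain ⟨h33, hS1, hS2, -, hI⟩ := hmodel i hM₁i α₀ hα₀ hma₁ U hU hU'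
  have hLS := hleft i hM₁i α₀ hα₀ hma₁ U hU hU'
  have hLH := hlettersH i hM₁i α₀ hα₀ hma₁ U hU hU'
  obtain ⟨hH0, hL2s⟩ := hG0C i hM₁i α₀ hα₀ hma₁ U hU hU'
  obtain ⟨hStH, hStL⟩ := hstepC i hM₁i α₀ hα₀ hma₁ U hU hU'
  have hHH := hLHH i hM₁i α₀ hα₀ hma₁ U hU hU'
  have hrowi := hrow i (hleL hM)
  obtain ⟨h260, -, hsize⟩ := hLg i (hleg hM)
  obtain ⟨⟨hlD0, hlD1, hlD2, hlD3, hlD4, hlD5⟩, ⟨hl10, hl11, hl12, hl13, hl14, hl15⟩⟩ := hl2N i U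
  obtain ⟨hH1D, hH11⟩ := hH1N i U
  obtain ⟨hIRD, hIR1⟩ := hIN i U
  obtain ⟨hHC0, hHC1⟩ := hHCN i U
  obtain ⟨hsymG, hsymG1⟩ := hsym i U
  obtain ⟨htrG, htrG1⟩ := htr i U
  have hlen := (hgeo i).lenle
  -- the second-argument saturation of d from the first-argument one and the symmetry of d
  have hRd₂ : ∀ a b b' : (geo i).Site, Rel i b b' → (geo i).dist a b = (geo i).dist a b' := fun a b b' h => by
    rw [(hgeo i).symm a b, (hgeo i).symm a b', hRdist i b b' a h]
  set θ : ℝ := θ₁ * ((geo i).M * α₀) with hθdef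
  set θ' : ℝ := θD * ((geo i).M * α₀) with hθ'def
  set θH' : ℝ := θH * ((geo i).M * α₀) with hθH'def
  set θ₂' : ℝ := θ₂ * ((geo i).M * α₀) with hθ₂'def
  have hθ : 0 ≤ θ := mul_nonneg hθ₁ hm0
  have hθ' : 0 ≤ θ' := mul_nonneg hθD hm0
  have hθH' : 0 ≤ θH' := mul_nonneg hθH hm0
  have hθ₂' : 0 ≤ θ₂' := mul_nonneg hθ₂ hm0
  have hq : θ * c ≤ 1 / 2 := by
    have h := small_aux₁₀ hθc hmθ
    calc θ * c = θ₁ * c * ((geo i).M * α₀) := by rw [hθdef]; ring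
      _ ≤ 1 / 2 := h
  have hq1 : θ * c < 1 := lt_one_of_le_half hq
  have hq₂ : B₂ * θ₂' * c * c ≤ 1 / 2 := by
    have h := small_aux₁₀ hB₂c hm₂
    calc B₂ * θ₂' * c * c = B₂ * θ₂ * c * c * ((geo i).M * α₀) := by rw [hθ₂'def]; ring
      _ ≤ 1 / 2 := h
  have hq₂1 : B₂ * θ₂' * c * c < 1 := lt_one_of_le_half hq₂
  have hinv0 : 0 ≤ (1 - θ * c)⁻¹ := inv_nonneg.mpr (sub_nonneg.mpr hq1.le)
  have hinv2 : (1 - θ * c)⁻¹ ≤ 2 := inv_one_sub_le_two hq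
  have hC0 : 0 ≤ B₀ * (1 - θ * c)⁻¹ := mul_nonneg hB₀ hinv0
  have hθ'le : θ' ≤ θD * a₁ := mul_le_mul_of_nonneg_left hma₁ hθD
  have hθH'le : θH' ≤ tH := mul_le_mul_of_nonneg_left hma₁ hθH
  have hθ₂'le : θ₂' ≤ θ₂ * a₁ := mul_le_mul_of_nonneg_left hma₁ hθ₂
  have hC1L : B₀ + θ' * (B₀ * (1 - θ * c)⁻¹) * c ≤ BL := by
    have h2 : θ' * (B₀ * (1 - θ * c)⁻¹) ≤ θD * a₁ * (2 * B₀) :=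
      mul_le_mul hθ'le (const_le_two_mul hB₀ hq) hC0 (mul_nonneg hθD ha₁.le)
    have h3 : θ' * (B₀ * (1 - θ * c)⁻¹) * c ≤ θD * a₁ * (2 * B₀) * c := mul_le_mul_of_nonneg_right h2 hc
    rw [hBL]; linarith
  -- the scale transfers of p. 398 at (ρ, α) and the uniform bound of their constants
  have hL0i : 0 < (geo i).L := lt_of_lt_of_le one_pos (hL1 i)
  have hL4 : (geo i).L ^ (4 : ℝ) ≤ Λu := Real.rpow_le_rpow hL0i.le (hLle i) (by norm_num)
  have hST : ∀ γ : ℝ, |γ| ≤ 4 → ScaleTransfer (geo i) ρ α ((geo i).L ^ |γ|) (fun y => (geo i).len y ^ γ) ∧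
      0 ≤ (geo i).L ^ |γ| ∧ (geo i).L ^ |γ| ≤ Λu := fun γ hγ =>
    ⟨scaleTransfer_rpow_of_260 h260 hsize (hL1 i) (hη i) γ hγ, Real.rpow_nonneg hL0i.le _,
      (B9Ineq347AllEntries.size_condition_compact (geo i).L γ _ (hL1 i) hγ hsize).2.trans hL4⟩
  obtain ⟨hST1, hΛ₁0, hΛ₁le⟩ := hST 1 (by norm_num)
  obtain ⟨hSTh, hΛh0, hΛhle⟩ := hST (1 / 2) (by rw [abs_of_nonneg (by norm_num : (0 : ℝ) ≤ 1 / 2)]; norm_num)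
  obtain ⟨hSTm, hΛm0, hΛmle⟩ := hST (-1) (by norm_num)
  have hST2 : ScaleTransfer (geo i) ρ α (Lc ^ (2 : ℝ)) (fun y => (geo i).len y ^ (2 : ℝ)) := by
    obtain ⟨h2, _, _⟩ := hST 2 (by norm_num)
    have hΛle : (geo i).L ^ |(2 : ℝ)| ≤ Lc ^ (2 : ℝ) := by
      rw [abs_of_pos (by norm_num : (0 : ℝ) < 2)]
      exact Real.rpow_le_rpow hL0i.le (hLle i) (by norm_num)
    exact fun y y' => (h2 y y').trans (mul_le_mul_of_nonneg_right hΛle (B9Ineq347AllEntries.weight_nonneg (geo i) hL0i (hη i) 2 y))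
  -- the uniform bounds of the member constants of the two blocks
  have hKL : constL2N B₀ θ θ' B₂ θ₂' c ((geo i).L ^ |(1 : ℝ)|) ((geo i).L ^ |(1 / 2 : ℝ)|) ((geo i).L ^ |(-1 : ℝ)|) NP ≤ KLu :=
    constL2N_le hB₀ hB₂ hc hθ' hθ'le hθ₂' hθ₂'le hq hq₂ hNP0 hΛ₁0 hΛ₁le hΛh0 hΛhle hΛm0 hΛmle
  have hKL2 : Fr * constL2N B₀ θ θ' B₂ θ₂' c ((geo i).L ^ |(1 : ℝ)|) ((geo i).L ^ |(1 / 2 : ℝ)|) ((geo i).L ^ |(-1 : ℝ)|) NP ≤ BL2 :=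
    (mul_le_mul_of_nonneg_left hKL hFr0).trans (le_max_left _ _)
  have hBhA : ∀ β, Bh β + θH' * (B₀ * (1 - θ * c)⁻¹) * c ≤ Bh β + tH * (2 * B₀) * c := fun β => by
    have h := mul_le_mul_of_nonneg_right (mul_le_mul hθH'le (const_le_two_mul hB₀ hq) hC0 htH0) hc
    linarith
  have hmCE : 0 ≤ (m : ℝ) * CL * Real.exp (r * ρf) := mul_nonneg (mul_nonneg hm00 (zero_le_one.trans hCL1)) (Real.exp_nonneg _)
  have hβo : ∀ β, 0 ≤ β → β < 1 →
      (m : ℝ) * CL * Real.exp (r * ρf) * (Bh β + θH' * (B₀ * (1 - θ * c)⁻¹) * c) ≤ Bβo β ∧ 0 ≤ Bβo β := fun β _ _ =>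
    ⟨(mul_le_mul_of_nonneg_left (hBhA β) hmCE).trans (le_max_left _ _), hBβo0 β⟩
  have hεo : ∀ ε, 0 < ε → ε ≤ 1 →
      Real.exp (r * ρf) * (Bi ε + (B₀ + θ' * (B₀ * (1 - θ * c)⁻¹) * c) * (geo i).L ^ |(1 : ℝ)| * θH' * c) ≤ Bεo ε ∧ 0 ≤ Bεo ε := by
    intro ε h0 h1
    have h : (B₀ + θ' * (B₀ * (1 - θ * c)⁻¹) * c) * (geo i).L ^ |(1 : ℝ)| * θH' * c ≤ BL * Λu * tH * c :=
      mul_le_mul_of_nonneg_right (mul_le_mul (mul_le_mul hC1L hΛ₁le hΛ₁0 hBL0) hθH'le hθH' (mul_nonneg hBL0 hΛu0)) hc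
    refine ⟨le_trans ?_ (le_max_left _ _), hBεo0 ε⟩
    exact mul_le_mul_of_nonneg_left (by linarith) (Real.exp_nonneg _)
  have hεβo : ∀ ε β, 0 < ε → ε ≤ 1 → 0 ≤ β → β < 1 →
      CL * Real.exp (r * ρf) * (Bi2 ε β + (Bh β + θH' * (B₀ * (1 - θ * c)⁻¹) * c) * (geo i).L ^ |(1 : ℝ)| * θH' * c) ≤ Bεβo ε β ∧
        0 ≤ Bεβo ε β := by
    intro ε β hε0 hε1 h0 h1
    have hA0 : 0 ≤ Bh β + θH' * (B₀ * (1 - θ * c)⁻¹) * c := add_nonneg (hBh β h0 h1) (mul_nonneg (mul_nonneg hθH' hC0) hc)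
    have hA1 : 0 ≤ Bh β + tH * (2 * B₀) * c := hA0.trans (hBhA β)
    have h : (Bh β + θH' * (B₀ * (1 - θ * c)⁻¹) * c) * (geo i).L ^ |(1 : ℝ)| * θH' * c ≤ (Bh β + tH * (2 * B₀) * c) * Λu * tH * c :=
      mul_le_mul_of_nonneg_right (mul_le_mul (mul_le_mul (hBhA β) hΛ₁le hΛ₁0 hA1) hθH'le hθH' (mul_nonneg hA1 hΛu0)) hc
    refine ⟨le_trans ?_ (le_max_left _ _), hBεβo0 ε β⟩
    exact mul_le_mul_of_nonneg_left (by linarith) (mul_nonneg (zero_le_one.trans hCL1) (Real.exp_nonneg _))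
  -- the two blocks of a kernel family co-read by A ∈ {G, G₁} (with (Δ_a − T)A = I), proved and weakened to the uniform constants
  have resK : ∀ (K : B9.KernelFamily (geo i) (bg i)) (A T : Module.End ℝ (X i → ℝ)), ((𝔬 i).S0 U - T) * A = 1 →
      HasMaj (cNorm (R₀ i) (H₀ i) (𝔬 i).blk (hgeo i).lenle 1) (cNorm (R₀ i) (H₀ i) (𝔬 i).blk (hgeo i).lenle 1) ((𝔬 i).G0 U ∘ₗ T)
        (fun a b => θ * Real.exp (-(δK * (geo i).dist a b))) →
      HasMaj (cNorm (R₀ i) (H₀ i) (𝔬 i).blk (hgeo i).lenle 2) (cNorm (R₀ i) (H₀ i) (𝔬 i).blk (hgeo i).lenle 2) ((𝔬 i).G0 U ∘ₗ T)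
        (fun a b => θ * Real.exp (-(δK * (geo i).dist a b))) →
      HasMaj (cNorm (R₀ i) (H₀ i) (𝔬 i).blk (hgeo i).lenle 2) (cNorm (R₀ i) (H₀ i) (𝔬 i).blkY (hgeo i).lenle 1)
        ((𝔬 i).D U ∘ₗ (𝔬 i).G0 U ∘ₗ T) (fun a b => θ' * Real.exp (-(δK * (geo i).dist a b))) →
      (∀ β : ℝ, 0 ≤ β → β < 1 → HasMaj (cNormR (R₀ i) (H₀ i) (𝔬 i).blk (hgeo i).lenle (-2))
        (cNormR (R₀ i) (H₀ i) (𝔭 i).blkPY (hgeo i).lenle (β - 1)) (((𝔭 i).ΦY U β ∘ₗ (𝔬 i).D U ∘ₗ (𝔬 i).G0 U) ∘ₗ T)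
        (fun a b => θH' * Real.exp (-(δK * (geo i).dist a b)))) →
      (∀ β : ℝ, 0 ≤ β → β < 1 → HasMaj (cNormR (R₀ i) (H₀ i) (𝔬 i).blk (hgeo i).lenle (-1))
        (cNormR (R₀ i) (H₀ i) (𝔭 i).blkPX (hgeo i).lenle (β - 1)) (((𝔭 i).ΦX U β ∘ₗ (𝔬 i).G0 U) ∘ₗ T)
        (fun a b => θH' * Real.exp (-(δK * (geo i).dist a b)))) →
      (∀ ε : ℝ, 0 < ε → HasMaj (bH i ε) (cNormR (R₀ i) (H₀ i) (𝔬 i).blk (hgeo i).lenle 1) (T ∘ₗ ((𝔬 i).G0 U ∘ₗ (𝔬 i).Dstar U))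
        (fun a b => θH' * Real.exp (-(δK * (geo i).dist a b)))) →
      BlockBd (g := toB6 (geo i) (R₀ i) (H₀ i)) (𝔬 i).blk (𝔬 i).blk T
        (fun (y y' : (geo i).Site) => θ₂' * ((geo i).len y)⁻¹ * ((geo i).len y')⁻¹ * Real.exp (-(δK * (geo i).dist y y'))) →
      IsTransposePair A A → IsTransposePair ((𝔬 i).D U ∘ₗ A) (A ∘ₗ (𝔬 i).Dstar U) →
      L2ReadsNbr (R := R₀ i) (H := H₀ i) K 0 U (Rel i) r Cev (𝔬 i).blk (𝔬 i).blk (ev i) A →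
      L2ReadsNbr (R := R₀ i) (H := H₀ i) K 1 U (Rel i) r Cev (𝔬 i).blkY (𝔬 i).blk (ev i) ((𝔬 i).D U ∘ₗ A) →
      L2ReadsNbr (R := R₀ i) (H := H₀ i) K 2 U (Rel i) r Cev (𝔬 i).blk (𝔬 i).blkY (evY i) (A ∘ₗ (𝔬 i).Dstar U) →
      L2ReadsNbr (R := R₀ i) (H := H₀ i) K 3 U (Rel i) r Cev ((𝔬 i).blk ∘ Prod.fst) (𝔬 i).blk (ev i)
        (familyOp (fun q : P × P => (Dd i U q.1 ∘ₗ Dd i U q.2) ∘ₗ A)) →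
      L2ReadsNbr (R := R₀ i) (H := H₀ i) K 4 U (Rel i) r Cev (𝔬 i).blkY (𝔬 i).blkY (evY i) ((𝔬 i).D U ∘ₗ (A ∘ₗ (𝔬 i).Dstar U)) →
      L2ReadsNbr (R := R₀ i) (H := H₀ i) K 5 U (Rel i) r Cev ((𝔬 i).blk ∘ Prod.fst) (𝔬 i).blk (ev i)
        (familyOp (fun q : P × P => A ∘ₗ (Dds i U q.1 ∘ₗ Dds i U q.2))) →
      H1ReadsNbr K U (𝔭 i) (Rel i) r (𝔬 i).blk (𝔬 i).blkY (ev i) (evY i) ((𝔬 i).D U ∘ₗ A) (A ∘ₗ (𝔬 i).Dstar U) →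
      InputReadsNbr K U (𝔭 i) (bH i) r (𝔬 i).blkY (evY i) ((𝔬 i).D U ∘ₗ (A ∘ₗ (𝔬 i).Dstar U)) →
      L2Block K BL2 ρf U ∧ B9.Ineq343_345 K Bβo Bεo Bεβo ρf U := by
    intro K A T hIA hK1 hK2 hKD hpY hpX htD hT2 hsymA htrA hl0 hl1 hl2 hl3 hl4 hl5 hH1 hIRA
    have hl2B := l2Block_of_step_nbr (hgeo i) (𝔬 i) (Dd i) (Dds i) (Rel i) (ev i) (evY i) hrowi hθ hθ' hθ₂' hB₀ hB₂ hσ hα0 hρ.le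
      hρS hρδ hq1 hq₂1 hρf.le hρf1 hρf2 hΛ₁0 hΛh0 hΛm0 hST1 hSTh hSTm hI.invG0' hIA h33.e0 hLS.e1 h33.e2 hL2s hK1 hK2 hKD hT2
      hsymA htrA hRd₂ (hmult i) (hnbr i) hCL1 (hCL i) hCev hl0 hl1 hl2 hl3 hl4 hl5
    have hHo := holder_of_step_nbr (hgeo i) (𝔬 i) (𝔭 i) (bH i) (Rel i) (ev i) (evY i) hrowi hθ hθ' hθH' hB₀ hσ hα0 hρ.le hρS hρδ
      hq1 hρf.le hρf1 hΛ₁0 hBh hBi hBi2 hST1 hI.invG0' hIA h33.e0 hLS.e1 h33.e2 hH0 hK1 hK2 hKD hpY hpX htD hRd₂ (hmult i) hCL1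
      (hCL i) hH1 hIRA
    exact ⟨l2Block_mono (S i) hl2B hKL2 hBL20 le_rfl, ineq343_345_mono_on (S i) hHo (hgeo i).lenpos hβo hεo hεβo le_rfl⟩
  -- the Hölder member of (3.133) for H = A∘Q*∘C, proved and weakened to the uniform constant and the rate ρ_f ∕ 2
  have hfix := fix_of_inverses hI.invG0' hI.invG
  have hfix1 := fix_of_inverses hI.invG0' hI.invG1
  have hKH0 : 0 ≤ B₃ * B₃ * c * (1 - θ * c)⁻¹ := mul_nonneg hB33 hinv0
  have hH0m : HasMaj (cNorm (R₀ i) (H₀ i) (𝔬 i).blkZ (hgeo i).lenle 2) (cNorm (R₀ i) (H₀ i) (𝔬 i).blk (hgeo i).lenle 2) ((𝔬 i).Hm U)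
      (fun a b => B₃ * B₃ * c * (1 - θ * c)⁻¹ * Real.exp (-(ρ * (geo i).dist a b))) := by
    rw [hI.eq126]
    exact H_entry0 (hgeo i) hrowi hc hθ hB₃ hσ hρ.le hρ₃ hρδ hS2.step hLH.gQs2 hLH.c2 hfix hq1
  have hH10m : HasMaj (cNorm (R₀ i) (H₀ i) (𝔬 i).blkZ (hgeo i).lenle 2) (cNorm (R₀ i) (H₀ i) (𝔬 i).blk (hgeo i).lenle 2) ((𝔬 i).H1m U)
      (fun a b => B₃ * B₃ * c * (1 - θ * c)⁻¹ * Real.exp (-(ρ * (geo i).dist a b))) := by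
    rw [hI.eq129]
    exact H_entry0 (hgeo i) hrowi hc hθ hB₃ hσ hρ.le hρ₃ hρδ hS2.step1 hLH.gQs2 hLH.c12 hfix1 hq1
  have hα1 : α ≤ 1 := by linarith
  have resH : ∀ {Hk'' : B9.HKernel (geo i) (bg i)} (β : ℝ) (ζ : (geo i).Cut) (y y' : (geo i).Site),
      (∀ (ζ : (geo i).Cut) (y y' : (geo i).Site), (geo i).cutInT ζ y →
        Hk''.h U β ζ y' ≤ (CL ^ 2 * Real.exp (r * ((1 - α) * ρ)) * ((Bq β * B₃ * c + θH' * (B₃ * B₃ * c * (1 - θ * c)⁻¹) * c) *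
          Lc ^ (2 : ℝ))) * (geo i).cutH β ζ * ((geo i).len y) ^ (-(1 + β)) * ((geo i).len y') ^ (-(d : ℝ)) *
          Real.exp (-((1 - α) * ρ * (geo i).dist y y'))) →
      (geo i).cutInT ζ y →
      Hk''.h U β ζ y' ≤ Bβo β * (geo i).cutH β ζ * ((geo i).len y) ^ (-(1 + β)) * ((geo i).len y') ^ (-(d : ℝ)) *
        Real.exp (-(ρf / 2 * (geo i).dist y y')) := by
    intro Hk'' β ζ y y' h hζ
    refine (h ζ y y' hζ).trans ?_
    -- the member constant below the uniform one
    have hCle : CL ^ 2 * Real.exp (r * ((1 - α) * ρ)) * ((Bq β * B₃ * c + θH' * (B₃ * B₃ * c * (1 - θ * c)⁻¹) * c) * Lc ^ (2 : ℝ)) ≤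
        Bβo β := by
      have h1 : B₃ * B₃ * c * (1 - θ * c)⁻¹ ≤ 2 * (B₃ * B₃ * c) := by
        have := mul_le_mul_of_nonneg_left hinv2 hB33; linarith
      have h2 : θH' * (B₃ * B₃ * c * (1 - θ * c)⁻¹) * c ≤ tH * (2 * (B₃ * B₃ * c)) * c :=
        mul_le_mul_of_nonneg_right (mul_le_mul hθH'le h1 hKH0 htH0) hc
      have h3 : (Bq β * B₃ * c + θH' * (B₃ * B₃ * c * (1 - θ * c)⁻¹) * c) * Lc ^ (2 : ℝ) ≤
          (Bq β * B₃ * c + tH * (2 * (B₃ * B₃ * c)) * c) * Lc ^ (2 : ℝ) := mul_le_mul_of_nonneg_right (by linarith) hLc2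
      exact (mul_le_mul_of_nonneg_left h3 hCH30).trans (le_max_right _ _)
    -- the rate ρ_f ∕ 2 below (1 − α)ρ
    have hrate : Real.exp (-((1 - α) * ρ * (geo i).dist y y')) ≤ Real.exp (-(ρf / 2 * (geo i).dist y y')) :=
      Real.exp_le_exp.mpr (neg_le_neg (mul_le_mul_of_nonneg_right (by linarith) ((hgeo i).dnn y y')))
    have hnn : 0 ≤ (geo i).cutH β ζ * ((geo i).len y) ^ (-(1 + β)) * ((geo i).len y') ^ (-(d : ℝ)) :=
      mul_nonneg (mul_nonneg ((S i).cutH_nonneg β ζ) (Real.rpow_nonneg (hlen y) _)) (Real.rpow_nonneg (hlen y') _)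
    calc CL ^ 2 * Real.exp (r * ((1 - α) * ρ)) * ((Bq β * B₃ * c + θH' * (B₃ * B₃ * c * (1 - θ * c)⁻¹) * c) * Lc ^ (2 : ℝ)) *
          (geo i).cutH β ζ * ((geo i).len y) ^ (-(1 + β)) * ((geo i).len y') ^ (-(d : ℝ)) * Real.exp (-((1 - α) * ρ * (geo i).dist y y'))
        = CL ^ 2 * Real.exp (r * ((1 - α) * ρ)) * ((Bq β * B₃ * c + θH' * (B₃ * B₃ * c * (1 - θ * c)⁻¹) * c) * Lc ^ (2 : ℝ)) *
            ((geo i).cutH β ζ * ((geo i).len y) ^ (-(1 + β)) * ((geo i).len y') ^ (-(d : ℝ))) *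
            Real.exp (-((1 - α) * ρ * (geo i).dist y y')) := by ring
      _ ≤ Bβo β * ((geo i).cutH β ζ * ((geo i).len y) ^ (-(1 + β)) * ((geo i).len y') ^ (-(d : ℝ))) *
            Real.exp (-(ρf / 2 * (geo i).dist y y')) :=
          mul_le_mul (mul_le_mul_of_nonneg_right hCle hnn) hrate (Real.exp_nonneg _) (mul_nonneg (hBβo0 β) hnn)
      _ = Bβo β * (geo i).cutH β ζ * ((geo i).len y) ^ (-(1 + β)) * ((geo i).len y') ^ (-(d : ℝ)) *
            Real.exp (-(ρf / 2 * (geo i).dist y y')) := by ring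
  refine ⟨fun K hK => ?_, fun Hk' hK' β ζ y y' h0 h1 hζ => ?_⟩
  · have hK2 : K = GD i ∨ K = G₁ i := by simpa using hK
    rcases hK2 with rfl | rfl
    · exact resK _ _ _ hI.invG hS1.step hS2.step hLS.stepD hStH.pY hStH.pX hStH.tD hStL.t hsymG htrG hlD0 hlD1 hlD2 hlD3 hlD4 hlD5
        hH1D hIRD
    · exact resK _ _ _ hI.invG1 hS1.step1 hS2.step1 hLS.stepD1 hStH.pY1 hStH.pX1 hStH.tD1 hStL.t1 hsymG1 htrG1 hl10 hl11 hl12 hl13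
        hl14 hl15 hH11 hIR1
  · have hK2 : Hk' = Hk i ∨ Hk' = H₁k i := by simpa using hK'
    rcases hK2 with rfl | rfl
    · exact resH β ζ y y' (hkh_of_step_nbr (hgeo i) (𝔭 i) hrowi hθH' (hBq β) hB₃ hKH0 hLc2 hσ hρ.le hρ₃ hρδ hα1 h0 h1.le hHC0 hCL1
        (hCL i) hST2 (hHH.pQ β h0 h1) hLH.c2 (hStH.pY β h0 h1) hH0m hI.eq126 hfix) hζ
    · exact resH β ζ y y' (hkh_of_step_nbr (hgeo i) (𝔭 i) hrowi hθH' (hBq β) hB₃ hKH0 hLc2 hσ hρ.le hρ₃ hρδ hα1 h0 h1.le hHC1 hCL1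
        (hCL i) hST2 (hHH.pQ β h0 h1) hLH.c12 (hStH.pY1 β h0 h1) hH10m hI.eq129 hfix1) hζ

end Family

end

end Literature.MathematicalPhysics.QuantumFieldTheory.Balaban1983to89.B9Thm312WholeLeafCompleteNbr
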